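import Summits.BirchSwinnertonDyer.BirchSwinnertonDyer.Theorems.GenusKolyvaginAtTwoShaCardDvdPowAtTwoPosTOnCut
import Summits.BirchSwinnertonDyer.BirchSwinnertonDyer.Theorems.ByReductionTypeAtTwoRankOneAtTwoBigImageOddLocalOneDoorKolyvaginExactBridgeCLossless
import Summits.BirchSwinnertonDyer.BirchSwinnertonDyer.Theorems.RamifiedHeegnerPairRamifiedPairUpperBoundOfUpperHalfOverK
import Literature.NumberTheory.EllipticCurves.SelmerTrivialCorankProofs
import Literature.NumberTheory.EllipticCurves.LFunctionSmulProofs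
import HarnessLib

/-!
# Route `GenusKolyvaginAtTwo`, supply cruxes 23491 (Δ<0) / 25504 (Δ>0): the depth-zero kernels K₁ / K₁⁺, the twin's `BSD₂` (U₂) and
# Kolyvagin EXACTNESS at `2` are LOSSLESS — all of them FOLLOW from the leaf `Rank1Residual.NonCMAtTwo` modulo PRINT

Seat `bsd-line-gk2-p5` g34 (cell `bsd-f1-sign2`, WIDTH-5 attach), `--supports stmt-BirchSwinnertonDyer-23491 --as helper`.
THEOREMS ONLY (no definition, no named fact, no `sorry`).  **BSD is NOT proved by this file and no item is closed by it.**  Every theorem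
below is either unconditional or CONDITIONAL on the leaf `NonCMAtTwo` (the statement the route wants to prove) and on the route's PRINT items
`GrossZagierAllLevels` (24148), `EntireLFunctionRat` (19273), `MultPublishedInputsAtTwo` (19921), `MilneAnyModel` (24149): it is the CONVERSE
direction of the LEAD's route ledger (`GenusSupplyNarrow.nonCMAtTwo_of_items_of_selmerKernels`, p762455; `DepthZero.nonCMAtTwo_of_items_of_reductionBits`,
p762861), i.e. a LOSSLESSNESS certificate for the kernel items the planner-of-record is asked to file (memo `R11-SUPPLY-KERNELS-g21.md` §5).

WHAT IS PROVED.
* §1 (UNCONDITIONAL, sign-free) `natCard_primaryComponent_sha_baseChange_two_dvd_pow_of_shaExponent` — gk2-p3 g27's on-cut upper half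
  (`PlusDescent.natCard_primaryComponent_sha_two_dvd_pow_onCut_of_shaExponent` / `…onOddTwinCut…`) with the two rôles of `M₀` DECOUPLED: the
  frame exponent `M` (`2^(M+1) ∤ P(1)`) and the `ℚ`-side `Ш`-exponent `m` (`2^m · Ш(E/ℚ)[2^∞] = 0`) give `#Ш(E/K)[2^∞] ∣ 4^m`; hence
  `natCard_primaryComponent_sha_baseChange_two_eq_one_of_natCard_selmerGroup_eq_one`: **on the `#Sel₂(E) = 1` cells of BOTH supply cruxes
  `Ш(E/K)[2^∞] = 0`** (take `m = 0`: `Ш(E/ℚ)[2] = 0`), with NO multiplicative prime, NO Q2, NO print fact.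
* §2 `natCard_primaryComponent_sha_baseChange_two_eq_pow_of_bsdp_pair` — at every supply frame (rank-`0` member `E`, `(H2)`-admissible `K`,
  odd-Manin `Dt`, `2^(M₀) ∥ y_K`, a globally minimal twin `Wd ≅ E^(d_K)` of analytic rank `1`): `BSD₂(E) ∧ BSD₂(Wd)` + PRINT ⟹
  **`#Ш(E/K)[2^∞] = 4^(M₀)`** (fkl g7's `RankOneAtTwoOneDoor.shaExactC_of_bsdp_at` = Milne any-model iff + Gross–Zagier V.(2.2) over `K`, read
  for the rank-ZERO member; `c` odd).  §3 `…_of_nonCMAtTwo`: the same from the LEAF (the twin is non-CM of analytic rank `1 ≤ 1`).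
  So Kolyvagin EXACTNESS at `2` (U_T ∧ L_T, U⁺_T′ ∧ L⁺_T′ in value) is NECESSARY for the leaf.
* §4 **`K1_of_nonCMAtTwo`, `K1_pos_of_nonCMAtTwo`** — the depth-zero kernels K₁ (binder `hK1` of `GenusSupplyNarrow.stubC_negDisc_of_selmerSplit`,
  VERBATIM) and K₁⁺ (binder `hK1` of `GenusSupplyPos.stubC_posDisc_of_selmerSplit`, VERBATIM) FOLLOW from the leaf modulo the four PRINT items:
  §3 gives `#Ш(E/K)[2^∞] = 4^(M₀)`, §1 gives `= 1`, so `M₀ = 0`, contradicting the kernels' `1 ≤ M₀`.  With p762355 / p762538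
  (`R₁ → K₁`, `R₁⁺ → K₁⁺`) and the ledgers: on the depth-zero cells the line is an EQUIVALENCE modulo PRINT — K₁/K₁⁺ carry no slack and no
  over-claim; the beyond-print content of the line that EXCEEDS the leaf sits only in K₄/K₄⁺ (deep witnesses), Q2 and the residuals.
* §5 `minimalTwinBSDTwo_of_nonCMAtTwo` — U₂ (22985) is a sub-case of the leaf.

References: [GrossZagier1986] V.§2 (2.2); [GrossLMS1991] §2 Conj. (2.2), §5 Prop. 5.3; [McCallumLMS1991] §5 Lemma 5.1, Cor. 5.6;
[Kramer1981] Thm. 1, §2 Prop. 3; [Milne1972ArithmeticAV] §1 Thm. 1; [Miller2011LMS] Def. 1.1; [SilvermanAEC2009] Thm. X.4.2.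
-/

set_option autoImplicit false
set_option linter.dupNamespace false -- `Summit.<P>.<Sub>` repeats `BirchSwinnertonDyer` (D-0017)

noncomputable section

open scoped Classical

namespace Summit.BirchSwinnertonDyer.BirchSwinnertonDyer.Theorems.GenusSupplyNarrow.Lossless

open WeierstrassCurve NumberField Literature.NumberTheory.EllipticCurves Literature.NumberTheory.EllipticCurves.ModularForms
  Literature.NumberTheory.GaloisRepresentations
  Summit.BirchSwinnertonDyer.Rank1Residual
  Summit.BirchSwinnertonDyer.BirchSwinnertonDyer.Rank1Residual
  Summit.BirchSwinnertonDyer.BirchSwinnertonDyer.Theses.GenusKolyvaginAtTwo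
  Summit.BirchSwinnertonDyer.BirchSwinnertonDyer.Theorems.GenusExact.PlusDescent
  Summit.BirchSwinnertonDyer.BirchSwinnertonDyer.Theorems.RankOneAtTwoOneDoor

/-! ## §1 `Ш(E/K)[2^∞] = 0` on the `#Sel₂(E) = 1` cells (unconditional, sign-free) -/

/-- **The on-cut upper half with DECOUPLED exponents (sign-free).**  `W/ℚ` globally minimal, `C(W)` odd, `ρ̄_{W,2}` onto; `K` imaginary quadratic,
`d_K` odd, Heegner for `N_W`; a frame `(Dt, β, ι)`, a conductor-`1` datum `d₁` with `P(1)` of infinite order and `2^(M+1) ∤ P(1)`; `w(E) = +1`,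
`rank E(ℚ) = 0`; an elliptic `Wd ≅ E^(d_K)` with `#Sel₂(Wd) = 2` and the budget (`Δ < 0 ∧ ord₂ C(Wd) ≤ 1`) ∨ (`Δ > 0 ∧ ord₂ C(Wd) = 0`); and a
`ℚ`-side exponent `m`: every `2`-power-torsion `a ∈ Ш(E/ℚ)` has `2^m a = 0`.  Then **`#Ш(E/K)[2^∞] ∣ 2^(2m)`**.  Identical to gk2-p3 g27's
`natCard_primaryComponent_sha_two_dvd_pow_onCut_of_shaExponent` / `…onOddTwinCut…` except that the frame exponent `M` and the `Ш`-exponent `m`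
are not forced to coincide (the sign-free pair sandwich `natCard_sha_dvd_pow_of_pair_of_frame` never needed them equal).
[cite: Kramer1981, Thm. 1, §2 Prop. 3] [cite: GrossLMS1991, §5 Prop. 5.3] [cite: McCallumLMS1991, §5 Cor. 5.6] -/
theorem natCard_primaryComponent_sha_baseChange_two_dvd_pow_of_shaExponent
    (W : WeierstrassCurve ℚ) [W.IsElliptic] [W.IsGloballyMinimal] [NeZero (W.conductorNorm ℤ)]
    (K : Type) [Field K] [NumberField K]
    (hT : Odd W.tamagawaProduct) (hIQ : IsImaginaryQuadratic K) (hodd : Odd (NumberField.discr K))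
    (hHe : SatisfiesHeegnerHypothesis (W.conductorNorm ℤ) K) (hs2 : W.HasSurjectiveModNGaloisRep 2)
    (Dt : ModularParametrizationData W (W.conductorNorm ℤ)) (β : ℤ) (ι : K →+* ℂ) (d₁ : KolyvaginHeegnerData Dt β ι 1)
    (hy : ¬ IsOfFinAddOrder d₁.derivedPoint) (M : ℕ)
    (hndiv : ¬ ∃ Q : (W.baseChange (ringClassField K ι 1)).toAffine.Point, ((2 ^ (M + 1) : ℕ) : ℤ) • Q = d₁.derivedPoint)
    (hw : W.rootNumber = 1) (hrk0 : W.mordellWeilRank = 0)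
    (Wd : WeierstrassCurve ℚ) [Wd.IsElliptic] (hWd : ∃ C : VariableChange ℚ, C • W.quadraticTwist (NumberField.discr K : ℚ) = Wd)
    (hSel : Nat.card (Wd.selmerGroup 2) = 2)
    (hbudget : (W.Δ < 0 ∧ padicValNat 2 Wd.tamagawaProduct ≤ 1) ∨ (0 < W.Δ ∧ padicValNat 2 Wd.tamagawaProduct = 0))
    {m : ℕ} (hB2Q : ∀ (k : ℕ) (a : W.galH1), a ∈ W.sha → ((2 ^ k : ℕ) : ℤ) • a = 0 → ((2 ^ m : ℕ) : ℤ) • a = 0) :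
    Nat.card (AddCommGroup.primaryComponent (W.baseChange K).sha 2) ∣ 2 ^ (2 * m) := by
  haveI : Fact (Nat.Prime 2) := ⟨Nat.prime_two⟩
  obtain ⟨τ, hτ, -⟩ := exists_conj_of_isImaginaryQuadratic (K := K) hIQ
  obtain ⟨h2tors, hrk, ⟨yK, hndiv', hanti⟩, hT0⟩ :=
    exists_frame_of_cut W K hIQ hHe hs2 hτ Dt β ι d₁ hy M hndiv hw hrk0 Wd hWd hSel
  have hexp := forall_primaryComponent_sha_two_pow_smul_eq_zero_of_galH1 W hB2Q
  haveI := finite_primaryComponent_sha_rat_two_of_exponent W hexp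
  obtain ⟨Cd, hCd⟩ := hWd
  rcases hbudget with ⟨hneg, hDEF⟩ | ⟨hpos, hDEF⟩
  · obtain ⟨hne, hneT, hbud⟩ := relIndex_mul_relIndex_le_four_of_Δ_neg W K hneg hIQ hodd hHe hT Cd hCd hDEF
    have h4 : Nat.card (AddSubgroup.torsionBy (↥W.sha) ((2 : ℕ) : ℤ)) ≤ 4 := by
      have h := natCard_sha_torsionBy_two_dvd_four_of_genusBudget_le_one_unramified W hneg hT hIQ hodd hHe Wd ⟨Cd, hCd⟩ hDEF hSel
      exact Nat.le_of_dvd (by norm_num) (by simpa using h)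
    exact (natCard_sha_dvd_pow_of_pair_of_frame W K hIQ hτ h2tors hrk yK M hndiv' hanti hT0 hne hneT hbud hexp h4).2
  · obtain ⟨hne, hneT, hbud⟩ := relIndex_mul_relIndex_le_four_of_padicValNat_eq_zero W K hIQ hodd hHe hT Cd hCd hDEF
    have h4 : Nat.card (AddSubgroup.torsionBy (↥W.sha) ((2 : ℕ) : ℤ)) ≤ 4 := by
      have h := natCard_sha_torsionBy_two_dvd_four_of_posDisc_of_padicValNat_eq_zero W hpos hT hIQ hodd hHe Wd ⟨Cd, hCd⟩ hDEF hSel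
      exact Nat.le_of_dvd (by norm_num) (by simpa using h)
    exact (natCard_sha_dvd_pow_of_pair_of_frame W K hIQ hτ h2tors hrk yK M hndiv' hanti hT0 hne hneT hbud hexp h4).2

/-- **`Ш(E/K)[2^∞] = 0` ON THE `#Sel₂(E) = 1` CELLS OF BOTH SUPPLY CRUXES — unconditional.**  Same frame as
`natCard_primaryComponent_sha_baseChange_two_dvd_pow_of_shaExponent`, with `r_an(E) = 0` (so `w(E) = +1` by the functional equation of the
newform of `Dt`) and `#Sel₂(E/ℚ) = 1` (so `rank E(ℚ) = 0` and `Ш(E/ℚ)[2^∞] = 0`: the `Ш`-exponent is `m = 0`): **`#Ш(E/K)[2^∞] = 1`**.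
No multiplicative prime, no Q2, no print fact; the frame exponent `M` is arbitrary.  (The LEAD's memo `DEPTH-ZERO-REDUCTION-CRITERION-g21.md`
§1 obtained `Ш(E/K)[2^∞] = 0` on this cell from SANDWICH′ + Cassels–Tate MODULO Q2 and on the cut only.)
[cite: Kramer1981, Thm. 1] [cite: SilvermanAEC2009, Thm. X.4.2] [cite: GrossLMS1991, §5 Prop. 5.3] -/
theorem natCard_primaryComponent_sha_baseChange_two_eq_one_of_natCard_selmerGroup_eq_one
    (W : WeierstrassCurve ℚ) [W.IsElliptic] [W.IsGloballyMinimal] [NeZero (W.conductorNorm ℤ)]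
    (K : Type) [Field K] [NumberField K]
    (hT : Odd W.tamagawaProduct) (hr0 : W.analyticRank = 0) (h1 : Nat.card (W.selmerGroup 2) = 1)
    (hIQ : IsImaginaryQuadratic K) (hodd : Odd (NumberField.discr K))
    (hHe : SatisfiesHeegnerHypothesis (W.conductorNorm ℤ) K) (hs2 : W.HasSurjectiveModNGaloisRep 2)
    (Dt : ModularParametrizationData W (W.conductorNorm ℤ)) (β : ℤ) (ι : K →+* ℂ) (d₁ : KolyvaginHeegnerData Dt β ι 1)
    (hy : ¬ IsOfFinAddOrder d₁.derivedPoint) (M : ℕ)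
    (hndiv : ¬ ∃ Q : (W.baseChange (ringClassField K ι 1)).toAffine.Point, ((2 ^ (M + 1) : ℕ) : ℤ) • Q = d₁.derivedPoint)
    (Wd : WeierstrassCurve ℚ) [Wd.IsElliptic] (hWd : ∃ C : VariableChange ℚ, C • W.quadraticTwist (NumberField.discr K : ℚ) = Wd)
    (hSel : Nat.card (Wd.selmerGroup 2) = 2)
    (hbudget : (W.Δ < 0 ∧ padicValNat 2 Wd.tamagawaProduct ≤ 1) ∨ (0 < W.Δ ∧ padicValNat 2 Wd.tamagawaProduct = 0)) :
    Nat.card (AddCommGroup.primaryComponent (W.baseChange K).sha 2) = 1 := by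
  haveI : Fact (Nat.Prime 2) := ⟨Nat.prime_two⟩
  -- `w(E) = +1` from `r_an(E) = 0`
  have hw : W.rootNumber = 1 :=
    (Literature.Barriers.BirchSwinnertonDyer.even_analyticRank_iff_of_isNewformOf_conductorLevel Dt.isNewformOf).mp
      (by rw [hr0]; exact Even.zero)
  -- `#Sel₂(E/ℚ) = 1`: `rank E(ℚ) = 0` and `Ш(E/ℚ)[2^∞] = 0`
  have h1' : Nat.card (W.selmerGroup ((2 : ℕ) : ℤ)) = 1 := by rw [Nat.cast_ofNat]; exact h1
  have hrk0 : W.mordellWeilRank = 0 :=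
    (rank_eq_zero_and_torsionBy_eq_bot_and_sha_inf_torsionBy_eq_bot_of_natCard_selmerGroup_eq_one W 2 h1').1
  have hbot : AddCommGroup.primaryComponent (↥W.sha) 2 = ⊥ := primaryComponent_sha_eq_bot_of_natCard_selmerGroup_eq_one W 2 h1'
  have hB2Q : ∀ (k : ℕ) (a : W.galH1), a ∈ W.sha → ((2 ^ k : ℕ) : ℤ) • a = 0 → ((2 ^ 0 : ℕ) : ℤ) • a = 0 := by
    intro k a ha hka
    have hmem : (⟨a, ha⟩ : ↥W.sha) ∈ AddCommGroup.primaryComponent (↥W.sha) 2 := by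
      refine (AddCommGroup.mem_primaryComponent).mpr ⟨k, Subtype.ext ?_⟩
      rw [AddSubgroupClass.coe_nsmul, ZeroMemClass.coe_zero, ← natCast_zsmul]
      exact hka
    rw [hbot, AddSubgroup.mem_bot] at hmem
    have ha0 : a = 0 := congrArg Subtype.val hmem
    rw [ha0]
    exact zsmul_zero _
  have hdvd := natCard_primaryComponent_sha_baseChange_two_dvd_pow_of_shaExponent W K hT hIQ hodd hHe hs2 Dt β ι d₁ hy M hndiv hw hrk0 Wd
    hWd hSel hbudget hB2Q
  simpa using hdvd

/-! ## §2 Exactness `#Ш(E/K)[2^∞] = 4^(M₀)` from `BSD₂` of the pair (the rank-zero member) -/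

/-- **`BSD₂(E) ∧ BSD₂(E^(d_K)) ⟹ #Ш(E/K)[2^∞] = 4^(M₀)` at every supply frame, modulo PRINT** (`GrossZagierAllLevels`, `EntireLFunctionRat`,
`MultPublishedInputsAtTwo`, `MilneAnyModel`).  `W/ℚ` globally minimal of analytic rank `0`, `ρ̄_{W,2}` onto, `C(W)` odd; `K` imaginary quadratic,
`d_K` odd `≠ −3`, Heegner for `N_W`; a datum `Dt` with ODD Manin constant; `d₁` conductor-`1` with `2^(M₀) ∥ P(1)` in `E(K[1])`; `Wd` a
globally minimal model of `E^(d_K)` of analytic rank `1`.  fkl g7's `RankOneAtTwoOneDoor.shaExactC_of_bsdp_at` (Milne's any-model iff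
`missingPPartOverCAt_baseChange_iff_bsdp` + Gross–Zagier `#Ш_an(E_K) = 4I²/(c² w_K² (∏c_ℓ)²)`) gives `ord₂ #Ш(E_K)[2^∞] + 2 v₂(c) = 2 M₀`;
`c` odd and `#Ш(E_K)[2^∞]` a power of `2` (finite: Milne/GZK inside `padicValRat_shaAnOverC_heegnerC`) finish.  CONDITIONAL on the two
`BSD₂` hypotheses; nothing about BSD is proved here. [cite: GrossZagier1986, V.§2 (2.2)] [cite: Milne1972ArithmeticAV, §1 Thm. 1]
[cite: McCallumLMS1991, §5 Lemma 5.1] [cite: Miller2011LMS, Def. 1.1] -/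
theorem natCard_primaryComponent_sha_baseChange_two_eq_pow_of_bsdp_pair
    (hGZ : GrossZagierAllLevels) (hL : EntireLFunctionRat) (hGZK : MultPublishedInputsAtTwo) (hMi : MilneAnyModel)
    (W : WeierstrassCurve ℚ) [W.IsElliptic] [W.IsGloballyMinimal] [NeZero (W.conductorNorm ℤ)]
    (hρ2 : W.HasSurjectiveModNGaloisRep 2) (hT : Odd W.tamagawaProduct) (hr0 : W.analyticRank = 0)
    (K : Type) [Field K] [NumberField K] (hIQ : IsImaginaryQuadratic K) (hodd : Odd (NumberField.discr K))
    (h3 : NumberField.discr K ≠ -3) (hHe : SatisfiesHeegnerHypothesis (W.conductorNorm ℤ) K)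
    (Dt : ModularParametrizationData W (W.conductorNorm ℤ)) (hc : Odd Dt.c) (β : ℤ) (ι : K →+* ℂ) (d₁ : KolyvaginHeegnerData Dt β ι 1)
    (M₀ : ℕ)
    (hdiv : ∃ Q : (W.baseChange (ringClassField K ι 1)).toAffine.Point, ((2 ^ M₀ : ℕ) : ℤ) • Q = d₁.derivedPoint)
    (hndiv : ¬ ∃ Q : (W.baseChange (ringClassField K ι 1)).toAffine.Point, ((2 ^ (M₀ + 1) : ℕ) : ℤ) • Q = d₁.derivedPoint)
    (Wd : WeierstrassCurve ℚ) [Wd.IsElliptic] [Wd.IsGloballyMinimal]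
    (hWd : ∃ C : VariableChange ℚ, C • W.quadraticTwist (NumberField.discr K : ℚ) = Wd) (hrd : Wd.analyticRank = 1)
    (hBW : BSDp W 2) (hBd : BSDp Wd 2) :
    Nat.card (AddCommGroup.primaryComponent (W.baseChange K).sha 2) = 2 ^ (2 * M₀) := by
  haveI : Fact (Nat.Prime 2) := ⟨Nat.prime_two⟩
  haveI hEK : (W.baseChange K).IsElliptic := inferInstanceAs ((W.map (algebraMap ℚ K)).IsElliptic)
  have h2 : Module.finrank ℚ K = 2 := hIQ.1
  have hD0 : (NumberField.discr K : ℚ) ≠ 0 := by exact_mod_cast NumberField.discr_ne_zero K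
  haveI hEt : (W.quadraticTwist (NumberField.discr K : ℚ)).IsElliptic := W.isElliptic_quadraticTwist hD0
  -- the twist itself has analytic rank `1`, so `ord_{s=1} L(E_K, s) = 1`
  have hrt : (W.quadraticTwist (NumberField.discr K : ℚ)).analyticRank = 1 := by
    obtain ⟨Cd, hCd⟩ := hWd
    rw [← hrd, ← hCd, analyticRank_smul]
  have hrK : (W.baseChange K).analyticRank = 1 :=
    (P2.analyticRank_baseChange_eq_one_iff W K hL h2).mpr (Or.inr ⟨hr0, hrt⟩)
  -- fkl g7: `ord₂ #Ш(E_K)[2^∞] + 2 v₂(c) = 2 M₀`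
  have hval := shaExactC_of_bsdp_at W K Dt β ι d₁ Wd (hGZ _ W K) hGZK hL hMi hρ2 hT (by rw [hr0]; exact zero_le_one) hIQ hodd h3 hHe
    hrK hdiv hndiv hWd (by rw [hrd]) hBd hBW
  have hvc : padicValInt 2 Dt.c = 0 :=
    padicValInt.eq_zero_of_not_dvd (fun h2c ↦ (Int.not_even_iff_odd.mpr hc) (even_iff_two_dvd.mpr h2c))
  simp only [hvc, Nat.cast_zero, mul_zero, add_zero] at hval
  -- `Ш(E_K)` is finite, so `#Ш(E_K)[2^∞]` is a power of `2`
  obtain ⟨hShaK, -⟩ := padicValRat_shaAnOverC_heegnerC W K Dt β ι d₁ (hGZ _ W K) hGZK hL hρ2 hT hIQ hodd h3 hHe hrK hdiv hndiv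
  haveI : Finite (W.baseChange K).sha := hShaK
  obtain ⟨k, hk⟩ := exists_natCard_addPrimaryComponent_eq_pow (A := ↥(W.baseChange K).sha) 2
  rw [hk, padicValNat.prime_pow] at hval
  have hk2 : k = 2 * M₀ := by exact_mod_cast hval
  rw [hk, hk2]

/-! ## §3 Exactness from the LEAF `NonCMAtTwo` -/

/-- **Kolyvagin exactness at `2` is NECESSARY for the leaf**: `NonCMAtTwo` + PRINT ⟹ `#Ш(E/K)[2^∞] = 4^(M₀)` at every supply frame of the
habitat (non-CM `E` of analytic rank `0`, `ρ̄_{E,2}` onto, `C(E)` odd; `(H2)`-admissible `K`; odd-Manin `Dt`; `2^(M₀) ∥ y_K`; a globally minimal twin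
`Wd ≅ E^(d_K)` of analytic rank `1`).  The leaf gives `BSD₂(E)` (`r_an = 0 ≤ 1`) and `BSD₂(Wd)` (the twin is non-CM — same `j` — of analytic rank
`1 ≤ 1`); then §2.  CONDITIONAL on the leaf (which is what the route wants to prove) — a losslessness statement, not progress on BSD.
[cite: GrossZagier1986, V.§2 (2.2)] [cite: Milne1972ArithmeticAV, §1 Thm. 1] [cite: Miller2011LMS, Def. 1.1] -/
theorem natCard_primaryComponent_sha_baseChange_two_eq_pow_of_nonCMAtTwo
    (hleaf : NonCMAtTwo) (hGZ : GrossZagierAllLevels) (hL : EntireLFunctionRat) (hGZK : MultPublishedInputsAtTwo) (hMi : MilneAnyModel)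
    (W : WeierstrassCurve ℚ) [W.IsElliptic] [W.IsGloballyMinimal] [NeZero (W.conductorNorm ℤ)]
    (hcm : ¬ W.HasCM) (hρ2 : W.HasSurjectiveModNGaloisRep 2) (hT : Odd W.tamagawaProduct) (hr0 : W.analyticRank = 0)
    (K : Type) [Field K] [NumberField K] (hIQ : IsImaginaryQuadratic K) (hodd : Odd (NumberField.discr K))
    (h3 : NumberField.discr K ≠ -3) (hHe : SatisfiesHeegnerHypothesis (W.conductorNorm ℤ) K)
    (Dt : ModularParametrizationData W (W.conductorNorm ℤ)) (hc : Odd Dt.c) (β : ℤ) (ι : K →+* ℂ) (d₁ : KolyvaginHeegnerData Dt β ι 1)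
    (M₀ : ℕ)
    (hdiv : ∃ Q : (W.baseChange (ringClassField K ι 1)).toAffine.Point, ((2 ^ M₀ : ℕ) : ℤ) • Q = d₁.derivedPoint)
    (hndiv : ¬ ∃ Q : (W.baseChange (ringClassField K ι 1)).toAffine.Point, ((2 ^ (M₀ + 1) : ℕ) : ℤ) • Q = d₁.derivedPoint)
    (Wd : WeierstrassCurve ℚ) [Wd.IsElliptic] [Wd.IsGloballyMinimal]
    (hWd : ∃ C : VariableChange ℚ, C • W.quadraticTwist (NumberField.discr K : ℚ) = Wd) (hrd : Wd.analyticRank = 1) :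
    Nat.card (AddCommGroup.primaryComponent (W.baseChange K).sha 2) = 2 ^ (2 * M₀) := by
  have hD0 : (NumberField.discr K : ℚ) ≠ 0 := by exact_mod_cast NumberField.discr_ne_zero K
  have hBW : BSDp W 2 := hleaf W hcm (by rw [hr0]; exact zero_le_one)
  obtain ⟨Cd, hCd⟩ := hWd
  have hcmd : ¬ Wd.HasCM := RamifiedPairUpperBound.not_hasCM_of_smul_quadraticTwist_eq hD0 hCd hcm
  have hBd : BSDp Wd 2 := hleaf Wd hcmd (by rw [hrd])
  exact natCard_primaryComponent_sha_baseChange_two_eq_pow_of_bsdp_pair hGZ hL hGZK hMi W hρ2 hT hr0 K hIQ hodd h3 hHe Dt hc β ι d₁ M₀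
    hdiv hndiv Wd ⟨Cd, hCd⟩ hrd hBW hBd

/-! ## §4 The depth-zero kernels K₁ (Δ<0) and K₁⁺ (Δ>0) FOLLOW from the leaf modulo PRINT -/

/-- **K₁ ⟸ LEAF + PRINT.**  The kernel K₁ of the Δ<0 supply crux 23491 — VERBATIM the binder `hK1` of
`GenusSupplyNarrow.stubC_negDisc_of_selmerSplit` (p762183; = Kolyvagin's conjecture, base case at `p = 2`, on the `#Sel₂(E) = 1` narrow cell:
«the C‴-frame with `1 ≤ M₀` is contradictory») — follows from `NonCMAtTwo` and the four PRINT items: §3 gives `#Ш(E/K)[2^∞] = 4^(M₀)`, §1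
gives `#Ш(E/K)[2^∞] = 1`, so `M₀ = 0`.  Together with `DepthZero.K1_of_reductionBit` (R₁ → K₁, p762355) and the ledger p762861: on this cell the
line's kernel is EXACTLY as strong as the leaf modulo PRINT (no slack, no over-claim).  CONDITIONAL on the leaf; BSD is NOT proved by this.
[cite: GrossZagier1986, V.§2 (2.2)] [cite: Kramer1981, Thm. 1] [cite: Milne1972ArithmeticAV, §1 Thm. 1] [cite: McCallumLMS1991, §5 Lemma 5.1] -/
theorem K1_of_nonCMAtTwo
    (hleaf : NonCMAtTwo) (hGZ : GrossZagierAllLevels) (hL : EntireLFunctionRat) (hGZK : MultPublishedInputsAtTwo) (hMi : MilneAnyModel) :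
    ∀ (W : WeierstrassCurve ℚ) [W.IsElliptic] [W.IsGloballyMinimal] [NeZero (W.conductorNorm ℤ)],
      ¬ W.HasCM → W.analyticRank = 0 → (∀ n : ℕ, 0 < n → W.HasSurjectiveModNGaloisRep ((2 : ℤ) ^ n)) →
      Odd W.tamagawaProduct → W.Δ < 0 → Nat.card (W.selmerGroup 2) = 1 →
      ∀ (K : Type) [Field K] [NumberField K],
      IsImaginaryQuadratic K → Odd (NumberField.discr K) → NumberField.discr K ≠ -3 →
      SatisfiesHeegnerHypothesis (W.conductorNorm ℤ) K →
      ¬ IsSquare ((NumberField.discr K : ℚ) * -|W.Δ|) → ¬ IsSquare ((NumberField.discr K : ℚ) * (-(2 * |W.Δ|))) →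
      ∀ (Dt : ModularParametrizationData W (W.conductorNorm ℤ)),
      (∀ z ∈ Dt.L.lattice, ∃ w ∈ periodLattice Dt.f, z = (Dt.c : ℂ) * w) → Odd Dt.c →
      ∀ (β : ℤ) (ι : K →+* ℂ) (d₁ : KolyvaginHeegnerData Dt β ι 1), ¬ IsOfFinAddOrder d₁.derivedPoint →
      ∀ (M₀ : ℕ), (∃ Q : (W.baseChange (ringClassField K ι 1)).toAffine.Point, ((2 ^ M₀ : ℕ) : ℤ) • Q = d₁.derivedPoint) →
      (¬ ∃ Q : (W.baseChange (ringClassField K ι 1)).toAffine.Point, ((2 ^ (M₀ + 1) : ℕ) : ℤ) • Q = d₁.derivedPoint) →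
      1 ≤ M₀ →
      ∀ (Wd : WeierstrassCurve ℚ) [Wd.IsElliptic] [Wd.IsGloballyMinimal],
      (∃ C : WeierstrassCurve.VariableChange ℚ, C • W.quadraticTwist (NumberField.discr K : ℚ) = Wd) →
      Wd.analyticRank = 1 → Nat.card (Wd.selmerGroup 2) = 2 → padicValNat 2 Wd.tamagawaProduct ≤ 1 →
      False := by
  intro W _ _ _ hcm hr0 hρ hT hneg h1 K _ _ hIQ hodd h3 hHe _hsq1 _hsq2 Dt _hoptDt hc β ι d₁ hy M₀ hdiv hndiv hM Wd _ _ hWd hrd hSel hDEF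
  have hρ2 : W.HasSurjectiveModNGaloisRep 2 := by simpa using hρ 1 one_pos
  have hpow := natCard_primaryComponent_sha_baseChange_two_eq_pow_of_nonCMAtTwo hleaf hGZ hL hGZK hMi W hcm hρ2 hT hr0 K hIQ hodd h3 hHe Dt
    hc β ι d₁ M₀ hdiv hndiv Wd hWd hrd
  have hone := natCard_primaryComponent_sha_baseChange_two_eq_one_of_natCard_selmerGroup_eq_one W K hT hr0 h1 hIQ hodd hHe hρ2 Dt β ι d₁
    hy M₀ hndiv Wd hWd hSel (Or.inl ⟨hneg, hDEF⟩)
  rw [hone] at hpow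
  have h0 : 2 * M₀ = 0 := by
    rcases (Nat.pow_eq_one.mp hpow.symm) with h | h
    · exact absurd h (by norm_num)
    · exact h
  omega

/-- **K₁⁺ ⟸ LEAF + PRINT** — the Δ>0 twin: the kernel K₁⁺ of the supply crux 25504 (VERBATIM the binder `hK1` of
`GenusSupplyPos.stubC_posDisc_of_selmerSplit`, p762235: the C⁺‴-frame on `#Sel₂(E) = 1` with the Tamagawa-ODD twin and `1 ≤ M₀` is contradictory)
follows from `NonCMAtTwo` and the four PRINT items (§3 and §1 with the archimedean budget `ord₂ C(Wd) = 0`).  With `DepthZero.K1_pos_of_reductionBit`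
(p762538): on this cell too the line is an equivalence modulo PRINT.  CONDITIONAL on the leaf; BSD is NOT proved by this.
[cite: GrossZagier1986, V.§2 (2.2)] [cite: Kramer1981, Thm. 1] [cite: Milne1972ArithmeticAV, §1 Thm. 1] [cite: McCallumLMS1991, §5 Lemma 5.1] -/
theorem K1_pos_of_nonCMAtTwo
    (hleaf : NonCMAtTwo) (hGZ : GrossZagierAllLevels) (hL : EntireLFunctionRat) (hGZK : MultPublishedInputsAtTwo) (hMi : MilneAnyModel) :
    ∀ (W : WeierstrassCurve ℚ) [W.IsElliptic] [W.IsGloballyMinimal] [NeZero (W.conductorNorm ℤ)],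
      ¬ W.HasCM → W.analyticRank = 0 → (∀ n : ℕ, 0 < n → W.HasSurjectiveModNGaloisRep ((2 : ℤ) ^ n)) →
      Odd W.tamagawaProduct → 0 < W.Δ →
      Nat.card (W.selmerGroup 2) = 1 →
      ∀ (K : Type) [Field K] [NumberField K],
      IsImaginaryQuadratic K → Odd (NumberField.discr K) → NumberField.discr K ≠ -3 →
      SatisfiesHeegnerHypothesis (W.conductorNorm ℤ) K →
      ¬ IsSquare ((NumberField.discr K : ℚ) * -|W.Δ|) → ¬ IsSquare ((NumberField.discr K : ℚ) * (-(2 * |W.Δ|))) →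
      ∀ (Dt : ModularParametrizationData W (W.conductorNorm ℤ)),
      (∀ z ∈ Dt.L.lattice, ∃ w ∈ periodLattice Dt.f, z = (Dt.c : ℂ) * w) → Odd Dt.c →
      ∀ (β : ℤ) (ι : K →+* ℂ) (d₁ : KolyvaginHeegnerData Dt β ι 1), ¬ IsOfFinAddOrder d₁.derivedPoint →
      ∀ (M₀ : ℕ), (∃ Q : (W.baseChange (ringClassField K ι 1)).toAffine.Point, ((2 ^ M₀ : ℕ) : ℤ) • Q = d₁.derivedPoint) →
      (¬ ∃ Q : (W.baseChange (ringClassField K ι 1)).toAffine.Point, ((2 ^ (M₀ + 1) : ℕ) : ℤ) • Q = d₁.derivedPoint) →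
      1 ≤ M₀ →
      ∀ (Wd : WeierstrassCurve ℚ) [Wd.IsElliptic] [Wd.IsGloballyMinimal],
      (∃ C : WeierstrassCurve.VariableChange ℚ, C • W.quadraticTwist (NumberField.discr K : ℚ) = Wd) →
      Wd.analyticRank = 1 → Nat.card (Wd.selmerGroup 2) = 2 → padicValNat 2 Wd.tamagawaProduct = 0 →
      False := by
  intro W _ _ _ hcm hr0 hρ hT hpos h1 K _ _ hIQ hodd h3 hHe _hsq1 _hsq2 Dt _hoptDt hc β ι d₁ hy M₀ hdiv hndiv hM Wd _ _ hWd hrd hSel hDEF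
  have hρ2 : W.HasSurjectiveModNGaloisRep 2 := by simpa using hρ 1 one_pos
  have hpow := natCard_primaryComponent_sha_baseChange_two_eq_pow_of_nonCMAtTwo hleaf hGZ hL hGZK hMi W hcm hρ2 hT hr0 K hIQ hodd h3 hHe Dt
    hc β ι d₁ M₀ hdiv hndiv Wd hWd hrd
  have hone := natCard_primaryComponent_sha_baseChange_two_eq_one_of_natCard_selmerGroup_eq_one W K hT hr0 h1 hIQ hodd hHe hρ2 Dt β ι d₁
    hy M₀ hndiv Wd hWd hSel (Or.inr ⟨hpos, hDEF⟩)
  rw [hone] at hpow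
  have h0 : 2 * M₀ = 0 := by
    rcases (Nat.pow_eq_one.mp hpow.symm) with h | h
    · exact absurd h (by norm_num)
    · exact h
  omega

/-! ## §5 U₂ is a sub-case of the leaf -/

/-- **`MinimalTwinBSDTwo ⟸ NonCMAtTwo`**: the route's declared rank-one input U₂ (stmt-BirchSwinnertonDyer-22985: `BSD₂` for non-CM curves of analytic
rank `1` with `#Sel₂ = 2`) is a sub-case of the leaf (analytic rank `1 ≤ 1`; the Selmer hypothesis is idle).  Bookkeeping only.
[cite: Miller2011LMS, Def. 1.1] -/
theorem minimalTwinBSDTwo_of_nonCMAtTwo (hleaf : NonCMAtTwo) : MinimalTwinBSDTwo := by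
  intro W _ _ hcm hr1 _hSel
  exact hleaf W hcm (by rw [hr1])

/-! ## §6 (appended, same seat) The two declared RESIDUALS are sub-cases of the leaf -/

/-- **`OffHabitatResidualAtTwo ⟸ NonCMAtTwo`**: the off-habitat residual (stmt-BirchSwinnertonDyer-22139; binder `hR` of `closes`) concludes `BSD₂(W)` for
non-CM `W` of analytic rank `≤ 1` off the habitat — a sub-case of the leaf (the habitat clause is idle).  Bookkeeping only: with §4–§5 EVERY declared
input of the route ledger p762861 except the `2`-converse items (19220/24948), Q2 (24880) and the positive-depth kernels K₄/K₄⁺ follows from the leaf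
modulo PRINT.  [cite: Miller2011LMS, Def. 1.1] -/
theorem offHabitatResidualAtTwo_of_nonCMAtTwo (hleaf : NonCMAtTwo) : OffHabitatResidualAtTwo := by
  intro W _ _ _ hcm hr _hoff
  exact hleaf W hcm hr

/-- **`OffCutResidualAtTwo ⟸ NonCMAtTwo`**: the off-cut residual (stmt-BirchSwinnertonDyer-25503; binder `hOff` of `closes`) concludes `BSD₂(W)` for
habitat curves (analytic rank `0`) off the live cut — a sub-case of the leaf (the cut clauses are idle).  Bookkeeping only.  [cite: Miller2011LMS, Def. 1.1] -/
theorem offCutResidualAtTwo_of_nonCMAtTwo (hleaf : NonCMAtTwo) : OffCutResidualAtTwo := by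
  intro W _ _ _ hcm hr0 _hρ _hT _hopt _hoff
  exact hleaf W hcm (by rw [hr0]; exact zero_le_one)

end Summit.BirchSwinnertonDyer.BirchSwinnertonDyer.Theorems.GenusSupplyNarrow.Lossless

end
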